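import Summits.Ventures.YMGap.Thresholds.StarLemmaGSuperSolutionDim
import Summits.Ventures.YMGap.Thresholds.StarWindowBoundSUN
import Summits.Ventures.YMGap.Thresholds.StarGaugeInvariance
import Literature.Probability.LatticeModels.DobrushinComparisonBoundary
import HarnessLib

/-!
# Venture YMGap — track (c) «DS» in GENERAL DIMENSION `d`: the star window contraction for `SU(N)` on
# `(ℤ/L)^d` from ANY single-link Dobrushin coefficient `c · n(x, z)` (generic-`N`, generic-`d` Lemma G)

HONEST FRAMING: venture file (cell `pub-ymgap`, seat ds-4, DIMENSION column of the `β₀(N, d)` table,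
STAR-DIMENSIONS.md), strong-coupling LATTICE bookkeeping for `SU(N)` lattice Yang–Mills on the torus
`(ℤ/L)^d` with the Wilson plaquette weight `exp(−β (N − Re tr U_q))` (tree coupling `β`, 't Hooft `β/N`);
nothing about the continuum, confinement at weak coupling, or the mass gap.  This is ds-1's generic-`N`
capstone `StarLemmaGSUN.star_window_of_isKRContraction` (`d = 4`) with the dimension made a variable: the
whole gauge-fixed star argument — Haar averaging of the observable at the centre, freezing one star link,
Föllmer's two-boundary comparison on the frozen star (`2d − 1` links) with the explicit super-solution
`dvec` of `StarLemmaGArrayDim`/`StarLemmaGSuperSolutionDim`, averaging over the two star links of the kicked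
plaquette — uses the group only through (i) the class-function property of the plaquette weight, (ii) the
bi-invariance of the Frobenius link distance, and (iii) the single-link Dobrushin coefficients
`C(x, z) = c · tInfluence x z` of the torus Wilson specification (`IsKRContraction`), taken as the
HYPOTHESIS.  The ONLY smallness condition is the door polynomial condition of `StarResolventDim`,
`(4d−4)c² + (4d−6)c < 1` (`d ≥ 2`, `c ≥ 0`), which gives `Δ_d(c) > 0` (the resolvent column is a
nonnegative super-solution) and `(2d−2)c < 1` (Föllmer's restricted row sums), and is equivalent to the
door `R_G^{(d)}(c) < 1`.  Output (array `Karr c` of `StarLemmaGArrayDim`):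

* `star_isLinkWindowContraction` — hypothesis (H1) of the star door for the star windows, array `Karr c`;
* `star_window_of_isKRContraction` — the four clauses (nonnegativity, support, (H1), (H2) with received
  sum EXACTLY `R_G^{(d)}(c) = (2d−2)c(1+c)/(1 − (2d−4)c − (2d−2)c²)`) bundled, ready for the any-`d` torus
  door `DSWindow.star_abs_covariance_le`;
* `star_window_of_oneLinkKRModulus` — the same fed by a one-link modulus `OneLinkKRModulus N R K` on the
  tilt ball `R ≥ 2(d−1)|β|/N` through the tree's any-`d` `isKRContraction_torusWilson` (`c = K|β|/N`).

References: ds-1 `StarWindowBoundSUN.lean` and ds-4 `StarWindowBoundLemmaG.lean` (`d = 4`, followed line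
by line); cell files STAR-DIMENSIONS.md, `GAUGE-STAR.md` (ds-2), `B4-BLUEPRINT.md`; H. Föllmer, LNM 1362
(1988) Ch. I; R. L. Dobrushin, S. B. Shlosman (1985).
-/

noncomputable section

open MeasureTheory Function Finset
open Literature.Probability.LatticeModels
open Literature.Probability.LatticeModels.DobrushinMetric
open Literature.MathematicalPhysics.QuantumFieldTheory
open Literature.MathematicalPhysics.QuantumFieldTheory.Balaban1983to89.StrongCouplingTorusWindow
open Summit.Ventures.YMGap.DSWindow
open Summit.Ventures.YMGap.StarKernel
open Summit.Ventures.YMGap.StarColumnDim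
open Summit.Ventures.YMGap.StarResolventDim (Delta gaugeR doorPoly Delta_pos_of_door coef_lt_one_of_door)
open Summit.Ventures.YMGap.StarLemmaGDim
open Summit.Ventures.YMGap.StarLemmaGSUN (wilsonPlaqWeight_conj suFrobDist_mul_mul)

namespace Summit.Ventures.YMGap.StarLemmaGDimSUN

variable {d L : ℕ} [NeZero L] {N : ℕ}

/-! ### The one-sided comparison (gauge fixed at `a`), dimension `d` -/

/-- **One-sided bound, generic coefficient, dimension `d`.**  Star plaquette `q` of `s` with star links
`a ≠ b`, boundary link `y ∈ q` off the star, `ω = η` off `y`, `f` a bounded measurable observable of the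
star links with per-link Lipschitz vector `δ` for `suFrobDist`; the `SU(N)` torus Wilson specification on
`(ℤ/L)^d` at tree coupling `β` is assumed to have single-link Dobrushin coefficients `c · tInfluence` with
`c ≥ 0` satisfying the door polynomial condition `(4d−4)c² + (4d−6)c < 1`.  Then
`|∫ f dγ_⋆(ω) − ∫ f dγ_⋆(η)| ≤ suFrobDist(ω_y, η_y) · Σ_{x ∈ ⋆} (c · kside c s a b x) δ_x`:
gauge-average `f` at `s`, freeze `a`, compare the two frozen kernels on `⋆ ∖ {a}` by Föllmer's comparison
with the super-solution `dvec` (`DobrushinMetric.abs_kernel_sub_le_of_superSolution`).  Port of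
`StarLemmaGSUN.oneSided` (`d = 4`). [folklore] -/
theorem oneSided (hd : 2 ≤ d) (hL : 3 ≤ L) {β c : ℝ} (hc0 : 0 ≤ c) (hcd : doorPoly d c < 1)
    (hK : IsKRContraction (torusWeightSpec (d := d) (L := L) (wilsonPlaqWeight N β)) suFrobDist
      linkNbrT fun e z => c * (tInfluence e z : ℝ))
    {s : Site d L}
    {q : Plaquette d L} (hq : q ∈ starPlaqs s) {y : Edge d L} (hyq : y ∈ plaqEdgesT q)
    (hy : y ∉ vertexStar s) {a b : Edge d L} (ha : a ∈ vertexStar s) (haq : a ∈ plaqEdgesT q)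
    (hb : b ∈ vertexStar s) (hbq : b ∈ plaqEdgesT q) (hab : a ≠ b)
    {ω η : GaugeConfig d L (Matrix.specialUnitaryGroup (Fin N) ℂ)} (hωη : ∀ e, e ≠ y → ω e = η e)
    {f : GaugeConfig d L (Matrix.specialUnitaryGroup (Fin N) ℂ) → ℝ} (hfm : Measurable f) {B : ℝ}
    (hB : ∀ U, |f U| ≤ B)
    (hfdep : DependsOn f (↑(vertexStar s) : Set (Edge d L))) {δ : Edge d L → ℝ} (hδ0 : ∀ x, 0 ≤ δ x)
    (hlip : ∀ (x : Edge d L) (σ τ : GaugeConfig d L (Matrix.specialUnitaryGroup (Fin N) ℂ)),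
      (∀ e, e ≠ x → σ e = τ e) →
      |f σ - f τ| ≤ δ x * suFrobDist (σ x) (τ x)) :
    |∫ U, f U ∂(torusWeightSpec (wilsonPlaqWeight N β) (vertexStar s) ω) -
        ∫ U, f U ∂(torusWeightSpec (wilsonPlaqWeight N β) (vertexStar s) η)| ≤
      suFrobDist (ω y) (η y) * ∑ x ∈ vertexStar s, (c * kside c s a b x) * δ x := by
  haveI : SecondCountableTopology (Matrix (Fin N) (Fin N) ℂ) :=
    inferInstanceAs (SecondCountableTopology (Fin N → Fin N → ℂ))
  haveI : SecondCountableTopology (Matrix.specialUnitaryGroup (Fin N) ℂ) :=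
    Topology.IsEmbedding.subtypeVal.secondCountableTopology
  set v : Matrix.specialUnitaryGroup (Fin N) ℂ → ℝ := wilsonPlaqWeight N β with hvdef
  have hvc : Continuous v := continuous_wilsonPlaqWeight (N := N) β
  have hv0 : ∀ g, 0 < v g := wilsonPlaqWeight_pos (N := N) β
  have hvconj : ∀ g h : Matrix.specialUnitaryGroup (Fin N) ℂ, v (g * h * g⁻¹) = v h :=
    wilsonPlaqWeight_conj β
  have hL1 : 1 < L := by omega
  have hΔ : 0 < Delta d c := Delta_pos_of_door hd hc0 hcd
  have hrow : (2 * (d : ℝ) - 2) * c < 1 := coef_lt_one_of_door hd hc0 hcd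
  have hd' : (2 : ℝ) ≤ d := by exact_mod_cast hd
  have hrow0 : 0 ≤ (2 * (d : ℝ) - 2) * c := mul_nonneg (by linarith) hc0
  have hΛ : ∀ e : Edge d L, (e.1 = s ∨ e.1.shift e.2 = s) → e ∈ vertexStar s :=
    fun e he => mem_vertexStar_iff'.2 he
  have ha' : a.1 = s ∨ a.1.shift a.2 = s := mem_vertexStar_iff'.1 ha
  have hya : y ≠ a := fun h => hy (h ▸ ha)
  -- Step 1: gauge average at `s`
  set fb := StarGauge.gaugeAvg s f with hfb
  have hfbm : Measurable fb := StarGauge.measurable_gaugeAvg s hfm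
  have hfbB : ∀ U, |fb U| ≤ B := StarGauge.abs_gaugeAvg_le s hB
  have hfbdep : DependsOn fb (↑(vertexStar s) : Set (Edge d L)) := StarGauge.dependsOn_gaugeAvg s hfdep
  have hfbinv : ∀ (g : Matrix.specialUnitaryGroup (Fin N) ℂ)
      (U : GaugeConfig d L (Matrix.specialUnitaryGroup (Fin N) ℂ)),
      fb (gaugeTransform (StarGauge.gaugeAt s g) U) = fb U :=
    StarGauge.gaugeAvg_gaugeTransform_gaugeAt s f
  have hfblip : ∀ (x : Edge d L) (σ τ : GaugeConfig d L (Matrix.specialUnitaryGroup (Fin N) ℂ)),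
      (∀ e, e ≠ x → σ e = τ e) →
      |fb σ - fb τ| ≤ δ x * suFrobDist (σ x) (τ x) :=
    StarGauge.lip_gaugeAvg s suFrobDist_mul_mul hfm hB hlip
  rw [StarGauge.integral_sub_integral_eq_gaugeAvg hvc hv0 hvconj hΛ ω η hfm hB]
  -- Step 2: freeze the link `a`
  rw [StarGauge.integral_torusWeightSpec_eq_erase hvc hv0 hvconj hL1 hΛ ha' ω hfbm hfbB hfbinv,
    StarGauge.integral_torusWeightSpec_eq_erase hvc hv0 hvconj hL1 hΛ ha' η hfbm hfbB hfbinv]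
  -- Step 3: under the frozen kernels, `fb = F := fb ∘ (update · a 1)` almost surely
  set Λ' := (vertexStar s).erase a with hΛ'
  set F : GaugeConfig d L (Matrix.specialUnitaryGroup (Fin N) ℂ) → ℝ := fun U => fb (update U a 1)
    with hF
  have hγ := isSpecification_torusWeightSpec (d := d) (L := L) hvc hv0
  have step3 : ∀ ζ : GaugeConfig d L (Matrix.specialUnitaryGroup (Fin N) ℂ),
      ∫ U, fb U ∂(torusWeightSpec v Λ' (update ζ a 1)) =
        ∫ U, F U ∂(torusWeightSpec v Λ' (update ζ a 1)) := by
    intro ζ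
    refine integral_congr_ae ?_
    filter_upwards [hγ.proper Λ' (update ζ a 1)] with U hU
    have hUa : U a = 1 := by rw [hU a (notMem_erase a _), update_self]
    show fb U = fb (update U a 1)
    rw [← hUa, update_eq_self]
  rw [step3 ω, step3 η]
  -- Step 4: Föllmer's comparison on `Λ'` with the super-solution `dvec`
  have hyΛ' : y ∉ Λ' := fun h => hy (mem_of_mem_erase h)
  have hω'η' : ∀ z, z ≠ y → update ω a 1 z = update η a 1 z := by
    intro z hz
    by_cases hza : z = a
    · subst hza; simp
    · rw [update_of_ne hza, update_of_ne hza, hωη z hz]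
  -- the test function `F`: measurable, bounded, depends on `Λ'`, Lipschitz vector `δ' = δ` off `a`, `0` at `a`
  have hFm : Measurable F :=
    hfbm.comp (measurable_update' (a := a) |>.comp (measurable_id.prodMk measurable_const))
  have hFB : ∀ U, |F U| ≤ B := fun U => hfbB _
  have hFdep : DependsOn F (↑Λ' : Set (Edge d L)) := by
    intro U U' hUU'
    show fb (update U a 1) = fb (update U' a 1)
    refine hfbdep fun e he => ?_
    by_cases hea : e = a
    · subst hea; simp
    · rw [update_of_ne hea, update_of_ne hea]
      exact hUU' e (Finset.mem_coe.2 (mem_erase.2 ⟨hea, Finset.mem_coe.1 he⟩))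
  set δ' : Edge d L → ℝ := fun z => if z = a then 0 else δ z with hδ'
  have hFlip : IsLipBound suFrobDist F δ' := by
    refine ⟨fun z => by simp only [hδ']; split_ifs; exacts [le_rfl, hδ0 z], fun z σ τ hστ => ?_⟩
    show |fb (update σ a 1) - fb (update τ a 1)| ≤ δ' z * suFrobDist (σ z) (τ z)
    by_cases hza : z = a
    · subst hza
      have hst : update σ z 1 = update τ z 1 := by
        funext e
        by_cases hez : e = z
        · subst hez; simp
        · rw [update_of_ne hez, update_of_ne hez, hστ e hez]
      rw [hst, sub_self, abs_zero]
      simp [hδ']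
    · have h := hfblip z (update σ a 1) (update τ a 1) (fun e hez => by
        by_cases hea : e = a
        · subst hea; simp
        · rw [update_of_ne hea, update_of_ne hea, hστ e hez])
      rw [update_of_ne hza, update_of_ne hza] at h
      simpa only [hδ', if_neg hza] using h
  have key := abs_kernel_sub_le_of_superSolution hγ hK (fun p q => suFrobDist_nonneg p q)
    (fun p q => suFrobDist_le p q) (R := 2 * Real.sqrt N) (by positivity) Λ' hyΛ' hω'η'
    (d := dvec c s y a b) (dvec_nonneg hd hc0 hΔ s y a b) (by simp [dvec])
    (fun x hx => dvec_superSolution hL hc0 hΔ hq hyq hy ha haq hb hbq hab hx)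
    (c := (2 * (d : ℝ) - 2) * c) hrow0 hrow
    (fun x hx => rowSum_frozenStar_le hL hc0 ha hx)
    hFm hFdep hFB hFlip
  -- rewrite the bound: `ω' y = ω y`, the sum over `Λ'` of `dvec · δ'` is the sum over `⋆` of `c · kside · δ`
  rw [update_of_ne hya, update_of_ne hya] at key
  refine key.trans (le_of_eq ?_)
  congr 1
  have hterm : ∀ z ∈ vertexStar s, dvec c s y a b z * δ' z = c * kside c s a b z * δ z := by
    intro z hz
    have hzy : z ≠ y := fun h => hy (h ▸ hz)
    by_cases hza : z = a
    · subst hza; simp [dvec, kside, hδ', hzy]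
    · simp only [dvec, if_neg hzy, if_pos hz, hδ', if_neg hza]
  rw [← sum_congr rfl hterm, hΛ']
  have haterm : dvec c s y a b a * δ' a = 0 := by simp [hδ']
  rw [sum_erase (vertexStar s) haterm]

/-! ### (H1), (H2) and the bundled window clauses, dimension `d` -/

/-- **(H1) for the `SU(N)` star windows on `(ℤ/L)^d` with the Lemma-G array `Karr c`**, from
single-link Dobrushin coefficients `c · tInfluence` of the torus Wilson specification (`d ≥ 2`, `c ≥ 0`
with `(4d−4)c² + (4d−6)c < 1`, torus side `L ≥ 3`): the two one-sided comparisons (`oneSided`, averaged)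
on the star boundary, quasilocality (`StarKernel.specAvg_vertexStar_eq_of_not_mem`) off it.  Port of
`StarLemmaGSUN.star_isLinkWindowContraction` (`d = 4`). [folklore] -/
theorem star_isLinkWindowContraction (hd : 2 ≤ d) (hL : 3 ≤ L) {β c : ℝ} (hc0 : 0 ≤ c)
    (hcd : doorPoly d c < 1)
    (hK : IsKRContraction (torusWeightSpec (d := d) (L := L) (wilsonPlaqWeight N β)) suFrobDist
      linkNbrT fun e z => c * (tInfluence e z : ℝ)) :
    IsLinkWindowContraction (d := d) (L := L) (wilsonPlaqWeight N β) suFrobDist starWin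
      fun e => Karr c e.1 := by
  have hL1 : 1 < L := by omega
  have hΔ : 0 < Delta d c := Delta_pos_of_door hd hc0 hcd
  intro e y hy ω η hωη f δ hfm hfB hfdep hδ0 hlip
  obtain ⟨B, hB⟩ := hfB
  set s := e.1
  change y ∉ vertexStar s at hy
  change DependsOn f (↑(vertexStar s) : Set (Edge d L)) at hfdep
  show |∫ U, f U ∂(torusWeightSpec (wilsonPlaqWeight N β) (vertexStar s) ω) -
      ∫ U, f U ∂(torusWeightSpec (wilsonPlaqWeight N β) (vertexStar s) η)| ≤
    (∑ x ∈ vertexStar s, Karr c s y x * δ x) * suFrobDist (ω y) (η y)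
  by_cases hyb : y ∈ starBoundary s
  · obtain ⟨⟨q, hq, hyq⟩, -⟩ := mem_starBoundary.1 hyb
    obtain ⟨a, b, hab, hf2⟩ := filter_mem_vertexStar_plaqEdgesT hL1 hq
    have ha2 : a ∈ (plaqEdgesT q).filter (fun e => e ∈ vertexStar s) := by rw [hf2]; simp
    have hb2 : b ∈ (plaqEdgesT q).filter (fun e => e ∈ vertexStar s) := by rw [hf2]; simp
    obtain ⟨haq, ha⟩ := mem_filter.1 ha2
    obtain ⟨hbq, hb⟩ := mem_filter.1 hb2
    have hA := oneSided hd hL hc0 hcd hK hq hyq hy ha haq hb hbq hab hωη hfm hB hfdep hδ0 hlip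
    have hB' := oneSided hd hL hc0 hcd hK hq hyq hy hb hbq ha haq hab.symm hωη hfm hB hfdep hδ0 hlip
    -- average the two one-sided bounds and compare with the array
    have hr0 : 0 ≤ suFrobDist (ω y) (η y) := suFrobDist_nonneg _ _
    have hpair : ∀ x ∈ vertexStar s,
        (c * kside c s a b x + c * kside c s b a x) / 2 ≤ Karr c s y x := by
      intro x hx
      have hKx : Karr c s y x = (c / 2) *
          ∑ q' ∈ (starPlaqs s).filter (fun q' => y ∈ plaqEdgesT q'),
            ∑ ab ∈ starPairsOf s q', kside c s ab.1 ab.2 x := by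
        simp only [Karr, if_pos (And.intro hx hy)]
      rw [hKx]
      have hqmem : q ∈ (starPlaqs s).filter (fun q' => y ∈ plaqEdgesT q') := mem_filter.2 ⟨hq, hyq⟩
      have hsub : ({(a, b), (b, a)} : Finset (Edge d L × Edge d L)) ⊆ starPairsOf s q := by
        intro p hp
        simp only [mem_insert, mem_singleton] at hp
        rcases hp with rfl | rfl
        · exact mem_starPairsOf.2 ⟨⟨haq, ha⟩, ⟨hbq, hb⟩, hab⟩
        · exact mem_starPairsOf.2 ⟨⟨hbq, hb⟩, ⟨haq, ha⟩, hab.symm⟩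
      have hinner : kside c s a b x + kside c s b a x ≤
          ∑ ab ∈ starPairsOf s q, kside c s ab.1 ab.2 x := by
        have hne : (a, b) ≠ (b, a) := fun h => hab (Prod.mk.inj h).1
        calc kside c s a b x + kside c s b a x
            = ∑ ab ∈ ({(a, b), (b, a)} : Finset (Edge d L × Edge d L)), kside c s ab.1 ab.2 x := by
              rw [sum_pair hne]
          _ ≤ _ := sum_le_sum_of_subset_of_nonneg hsub fun ab _ _ => kside_nonneg hd hc0 hΔ s _ _ _
      have houter : ∑ ab ∈ starPairsOf s q, kside c s ab.1 ab.2 x ≤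
          ∑ q' ∈ (starPlaqs s).filter (fun q' => y ∈ plaqEdgesT q'),
            ∑ ab ∈ starPairsOf s q', kside c s ab.1 ab.2 x := by
        have h := single_le_sum (f := fun q' => ∑ ab ∈ starPairsOf s q', kside c s ab.1 ab.2 x)
          (fun q' _ => sum_nonneg fun ab _ => kside_nonneg hd hc0 hΔ s _ _ _) hqmem
        exact h
      nlinarith
    have hsum : (∑ x ∈ vertexStar s, (c * kside c s a b x) * δ x +
        ∑ x ∈ vertexStar s, (c * kside c s b a x) * δ x) / 2 ≤
          ∑ x ∈ vertexStar s, Karr c s y x * δ x := by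
      rw [← sum_add_distrib, Finset.sum_div]
      refine sum_le_sum fun x hx => ?_
      have h := mul_le_mul_of_nonneg_right (hpair x hx) (hδ0 x)
      refine le_trans (le_of_eq ?_) h
      ring
    calc |∫ U, f U ∂(torusWeightSpec (wilsonPlaqWeight N β) (vertexStar s) ω) -
          ∫ U, f U ∂(torusWeightSpec (wilsonPlaqWeight N β) (vertexStar s) η)|
        = (|∫ U, f U ∂(torusWeightSpec (wilsonPlaqWeight N β) (vertexStar s) ω) -
            ∫ U, f U ∂(torusWeightSpec (wilsonPlaqWeight N β) (vertexStar s) η)| +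
          |∫ U, f U ∂(torusWeightSpec (wilsonPlaqWeight N β) (vertexStar s) ω) -
            ∫ U, f U ∂(torusWeightSpec (wilsonPlaqWeight N β) (vertexStar s) η)|) / 2 := by
          ring
      _ ≤ (suFrobDist (ω y) (η y) * ∑ x ∈ vertexStar s, (c * kside c s a b x) * δ x +
            suFrobDist (ω y) (η y) * ∑ x ∈ vertexStar s, (c * kside c s b a x) * δ x) / 2 := by
          gcongr
      _ = suFrobDist (ω y) (η y) * ((∑ x ∈ vertexStar s, (c * kside c s a b x) * δ x +
            ∑ x ∈ vertexStar s, (c * kside c s b a x) * δ x) / 2) := by ring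
      _ ≤ suFrobDist (ω y) (η y) * ∑ x ∈ vertexStar s, Karr c s y x * δ x :=
          mul_le_mul_of_nonneg_left hsum hr0
      _ = (∑ x ∈ vertexStar s, Karr c s y x * δ x) * suFrobDist (ω y) (η y) := mul_comm _ _
  · -- `y` off the star boundary: the kernel does not see `ω y`
    haveI : SecondCountableTopology (Matrix (Fin N) (Fin N) ℂ) :=
      inferInstanceAs (SecondCountableTopology (Fin N → Fin N → ℂ))
    haveI : SecondCountableTopology (Matrix.specialUnitaryGroup (Fin N) ℂ) :=
      Topology.IsEmbedding.subtypeVal.secondCountableTopology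
    rw [specAvg_vertexStar_eq_of_not_mem (continuous_wilsonPlaqWeight (N := N) β) s hfm hfdep
      hyb hωη, sub_self, abs_zero]
    exact mul_nonneg (sum_nonneg fun x _ => mul_nonneg (Karr_nonneg hd hc0 hΔ s y x) (hδ0 x))
      (suFrobDist_nonneg _ _)

/-- **The `SU(N)` star window on `(ℤ/L)^d`, all four clauses, from single-link Dobrushin coefficients
`c · tInfluence`** (`d ≥ 2`, `c ≥ 0` with `(4d−4)c² + (4d−6)c < 1`, torus side `L ≥ 3`): the array
`Karr c` is nonnegative, supported on boundary links within periodic sup-distance `1` of the centre,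
satisfies the window contraction (H1) for the star windows of the `SU(N)` torus Wilson specification at
tree coupling `β`, and has per-star received sum EXACTLY `R_G^{(d)}(c)` (`StarResolventDim.gaugeR`, `< 1`
under the same door condition by `gaugeR_lt_one_of_door`) — the input format of the any-`d` torus door
`DSWindow.star_abs_covariance_le`.  Generic-(`N`, `d`) form of `StarLemmaG.starWindowBound_lemmaG`.
[folklore] -/
theorem star_window_of_isKRContraction (hd : 2 ≤ d) (hL : 3 ≤ L) {β c : ℝ} (hc0 : 0 ≤ c)
    (hcd : doorPoly d c < 1)
    (hK : IsKRContraction (torusWeightSpec (d := d) (L := L) (wilsonPlaqWeight N β)) suFrobDist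
      linkNbrT fun e z => c * (tInfluence e z : ℝ)) :
    (∀ s y x, 0 ≤ Karr (L := L) (d := d) c s y x) ∧
      (∀ (s : Site d L) y x, Karr c s y x ≠ 0 → ∀ w ∈ linkEnds y, torusNorm (s - w) ≤ 1) ∧
      IsLinkWindowContraction (d := d) (L := L) (wilsonPlaqWeight N β) suFrobDist starWin
        (fun e => Karr c e.1) ∧
      ∀ (s : Site d L) (x : Edge d L), x ∈ vertexStar s → ∑ y, Karr c s y x = gaugeR d c := by
  have hΔ : 0 < Delta d c := Delta_pos_of_door hd hc0 hcd
  exact ⟨fun s y x => Karr_nonneg hd hc0 hΔ s y x, fun s y x h => Karr_loc s y x h,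
    star_isLinkWindowContraction hd hL hc0 hcd hK, fun s x hx => sum_Karr_eq_gaugeR hL hc0 hΔ hx⟩

/-- **The same, fed by a one-link modulus** (`isKRContraction_torusWilson`, any `d`): an `SU(N)` one-link
Kantorovich–Rubinstein modulus `OneLinkKRModulus N R K` on the tilt ball `R ≥ 2(d−1)|β|/N` (`2(d−1)`
plaquettes per link), `K ≥ 0`, with per-incidence coefficient `c = K·|β|/N` satisfying the door polynomial
condition, gives the four window clauses with the array `Karr (K·|β|/N)` and received sum
`R_G^{(d)}(K|β|/N)`. [folklore] -/
theorem star_window_of_oneLinkKRModulus (hd : 2 ≤ d) (hL : 3 ≤ L) (hN : 1 ≤ N) {β R K : ℝ}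
    (hK0 : 0 ≤ K) (hR : |β| / N * (2 * ((d : ℝ) - 1)) ≤ R)
    (hmod : Balaban1983to89.StrongCouplingDobrushinWindow.OneLinkKRModulus N R K)
    (hcd : doorPoly d (K * (|β| / N)) < 1) :
    (∀ s y x, 0 ≤ Karr (L := L) (d := d) (K * (|β| / N)) s y x) ∧
      (∀ (s : Site d L) y x, Karr (K * (|β| / N)) s y x ≠ 0 →
        ∀ w ∈ linkEnds y, torusNorm (s - w) ≤ 1) ∧
      IsLinkWindowContraction (d := d) (L := L) (wilsonPlaqWeight N β) suFrobDist starWin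
        (fun e => Karr (K * (|β| / N)) e.1) ∧
      ∀ (s : Site d L) (x : Edge d L), x ∈ vertexStar s →
        ∑ y, Karr (K * (|β| / N)) s y x = gaugeR d (K * (|β| / N)) := by
  have hL1 : 1 < L := by omega
  have hKR := isKRContraction_torusWilson (d := d) (N := N) (L := L) (by omega) hN hL1 hK0 hR hmod
  exact star_window_of_isKRContraction hd hL (mul_nonneg hK0 (by positivity)) hcd hKR

end Summit.Ventures.YMGap.StarLemmaGDimSUN

end
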